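import Mathlib
import HarnessLib
import HarnessLib.Audit
import Summits.PneNP.Statement
import Literature.Computability.Complexity.Circuit
import Literature.Computability.Complexity.CircuitClasses
import Literature.Computability.Complexity.Nondeterministic
import Literature.Computability.Complexity.ConstantDepth
import HarnessLib.Audit.Status.Attr

/-!
Route: OneSlice

DORMANT since 2026-08-25T02:48:27Z (reconciler: no traction for 7.3 d (last activity item-evidence-added at 2026-08-17T18:56:35Z); parked, not closed — `ledger route dormant route-PneNP-OneSlice --off` to reactivate) — unstaffed, not closed; items shared with open routes are served there. `ledger route dormant <id> --off` reactivates.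

# Route OneSlice — One slice suffices — monotone k-CLIQUE lower bounds on ever narrower Hamming
bands of the critical random graph, down to the single slice where Berkowitz makes them general

It suffices to show X = SliceTarget (card PneNP/PneNP/one-slice-suffices-band-gambit): for every
exponent c there are a clique size k ≥ 3 and δ > 0 such that for all large n and every edge count j
in the critical window |j − m_k(n)| ≤ m_k(n)^{3/4}, m_k(n) = ⌊C(n,2)·n^{−2/(k−1)}⌋ (the k-clique
threshold, E[#K_k] → 1/k!), every MONOTONE fan-in-2 {∧,∨}-circuit on the C(n,2) edge variables that
agrees with k-CLIQUE on all but a δ-fraction of the n-vertex graphs with exactly j edges (the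
Erdős–Rényi slice G(n,j)) has more than n^c gates. X is an average-case statement about monotone
circuits on ONE Hamming slice; on a slice negation is powerless (Berkowitz: ¬x_e ≡ T_{≥j}(x∖e),
polynomial overhead), so X is secretly a fixed-polynomial average-case lower bound for GENERAL
circuits computing the P-functions k-CLIQUE_n, and k → ∞ gives NP ⊄ P/poly. The route is the
deformation that reaches X: Rossman's average-case monotone bound (two thresholds far apart, known)
→ one threshold (crux #2, his open problem) → a band of constantly many adjacent slices (crux #3) →
one slice (X), with the AC⁰ analogue on the slice (crux #4) as the rung that isolates threshold
gates as the whole obstruction.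
Lean: `Summit.PneNP.PneNP.Theses.OneSlice.SliceTarget` i.e. `∀ c : ℕ, ∃ k : ℕ, 3 ≤ k ∧ ∃ δ : ℝ, 0 <
δ ∧ ∀ᶠ n : ℕ in Filter.atTop, ∀ j : ℕ, |(j : ℝ) - (⌊((n.choose 2 : ℕ) : ℝ) * (n : ℝ) ^ (-(2 : ℝ) /
((k : ℝ) - 1))⌋₊ : ℝ)| ≤ (⌊((n.choose 2 : ℕ) : ℝ) * (n : ℝ) ^ (-(2 : ℝ) / ((k : ℝ) - 1))⌋₊ : ℝ) ^
((3 : ℝ) / 4) → ∀ C : Literature.Computability.Complexity.Circuit ((⊤ : SimpleGraph (Fin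
n)).edgeSet), C.IsOver Literature.Computability.Complexity.monotoneBasis → ((Finset.univ.filter (fun
x : ((⊤ : SimpleGraph (Fin n)).edgeSet) → Bool => (Finset.univ.filter (fun e => x e = true)).card =
j ∧ C.eval x ≠ Literature.Computability.Complexity.cliqueFn n k x)).card : ℝ) ≤ δ *
((Finset.univ.filter (fun x : ((⊤ : SimpleGraph (Fin n)).edgeSet) → Bool => (Finset.univ.filter (fun
e => x e = true)).card = j)).card : ℝ) → n ^ c < C.size`

## Assembly
Deciding theorem (glue.lean, proved): `closes : SliceTarget → SingleThreshold → ConstantBand →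
SliceACZero → SliceMonotonization → CliqueCircuitsOfNPSubsetPPoly → TargetImpliesBand →
BandImpliesThreshold → Assembly → PneNP := fun hT _ _ _ hM hC _ _ hA => hA hM hC hT`; only
SliceTarget, the two supports SliceMonotonization / CliqueCircuitsOfNPSubsetPPoly and the item
Assembly are load-bearing, the cruxes #2–#4 are the ladder's milestones. Assembly (item, hypotheses
= route items only): by contradiction, ¬PneNP gives NP Bool ⊆ P Bool in Cook's model; the PROVED
model bridges P_bool_eq_holds, NP_bool_eq_holds, P_subset_PPoly_holds (tree theorems, used inside
the proof of Assembly and imported by its Theorems file — not hypotheses, not imports of this route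
file) give Nondeterministic.NP ⊆ PPoly; CliqueCircuitsOfNPSubsetPPoly yields B₂-circuits of size ≤
n^{c₁} for CLIQUE_k on the C(n,2) edge variables, every k, large n; SliceMonotonization (with M =
m_k(n) = ⌊C(n,2)·n^{−2/(k−1)}⌋, 0 < M < C(n,2) eventually because k ≥ 3) turns each into a monotone
circuit of size ≤ c₀(n^{c₁} + n^{c₀}) that is EXACT on the slice M, i.e. error 0 ≤ δ·#slice;
SliceTarget at c = c₀ + c₁ + 1, j = M gives n^c < c₀(n^{c₁} + n^{c₀}), false for n > 2c₀. Pure logic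
plus eventually-filters and floor/rpow arithmetic (~300 lines; candidate proof attached as evidence
on the Assembly item).

Rationale: WHY THIS LINE. Monotone circuit lower bounds are theorems but do not transfer
(Literature.Barriers.PneNP.MonotoneGap); the one place where they transfer EXACTLY is a single
Hamming slice [Berkowitz1982; Valiant1986; Wegener1985; Jukna2012 Thm 10.1], dormant because
worst-case monotone methods need test inputs many slices apart. Rossman [Rossman2014 =
doi:10.1109/focs.2010.26, Thm 1–2, pp.4,10 of the held text] moved the monotone method onto the
critical Erdős–Rényi graph: size-O(n^{k/4}) monotone circuits cannot solve k-CLIQUE a.a.s. on G(n,p)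
AND G(n,p+p^{1+ε}); his proof restricts the circuit by a clique-free critical background H and uses
the subcritical sprinkle G(n,p^{1+δ}) as negative instance (Lemma 17 + Thm 1) — the second threshold
IS that sprinkle; the single threshold is posed open in his §9 (p.11), where he also notes that
n^{f(k)} average-case bounds for general circuits give P ≠ NP, and in [Rossman2017, ECCC TR16-206
p.20] he speculates that "syntactic = semantic monotonicity in the average case", citing exactly the
slice + Berkowitz. This route makes that speculation quantitative along ONE parameter, the width w
of the Hamming band on which the monotone circuit must be correct (measure = G(n,p) conditioned on
the band; w = ∞: his theorem's regime; w ≍ √m: single threshold; w = O(1): mixture of adjacent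
slices; w = 0: the slice = general circuits), imports probabilistic combinatorics
(planted/conditioned contiguity at criticality, (p,q)-sunflowers / robust sunflowers and closure,
in-tree as Literature.Computability.Complexity.RobustSunflowerBound/MonotoneClosure
[CavalarKumarRossman2022]) and records the one structural fact found while planning: comparable
planted test pairs (H, H ∪ K_A) stop fitting inside a band of width w < C(k,2)/2 and are separated
there by the monotone threshold T_{≥j+w+1}, so the planted-pair paradigm ends at constant width and
the last step needs incomparable pairs ((H∖R) ∪ K_A vs H) — the Berkowitz regime. Versus route
NegLimited (negation budget, worst case): on the band B_w general = monotone + ⌈log₂(2w+1)⌉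
negations (Markov), so w is the average-case twin of its budget, read off the measure instead of the
circuit; no shared items.

RANKED CRUXES. #0 SliceTarget (target) — X above: ∀ c ∃ k ≥ 3 ∃ δ > 0, eventually in n, for every
central edge count j and every monotone {∧₂,∨₂}-circuit C on the edges of K_n: #{x : |x| = j, C(x) ≠
CLIQUE_k(x)} ≤ δ·#{x : |x| = j} ⟹ n^c < |C|. Weakest sufficient form (unbounded exponent); the
expected truth is |C| ≥ n^{k/4−O(1)} [Rossman2014 §9 speculation for general circuits; Thm 3 caps it
at n^{k/4+O(1)}]. Equivalent up to polynomial factors to the same statement for general B₂-circuits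
(SliceMonotonization), hence STRONGER than NP ⊄ P/poly: it can fail while PneNP holds. (why it might
fail: average-case k-clique DETECTION on the critical slice might be in SIZE(n^C) with C independent
of k for general (= monotone, here) circuits — no worst-to-average reduction is known at threshold
(counting is hard on average only for denser G(n,p), BBB FOCS19); and any proof must be
non-natural.) [Rossman2014, Berkowitz1982, Valiant1986, Rossman2017]
#2 SingleThreshold (crux) — Rossman's open problem in unbounded-exponent form: ∀ c ∃ k ≥ 3 ∃ δ > 0,
eventually in n, every monotone {∧₂,∨₂}-circuit C with Pr_{G ~ G(n, n^{−2/(k−1)})}[C(G) ≠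
CLIQUE_k(G)] ≤ δ has more than n^c gates (product measure written as the finite sum Σ_x
p^{|x|}(1−p)^{C(n,2)−|x|}). Known: the same with correctness at two densities p and p+p^{1+ε}
[Rossman2014 Thm 2, strongest form p.4]; AC⁰ single threshold [Rossman2008]; upper bound
n^{k/4+O(1)} monotone for every p [Rossman2014 Thm 3]. Reformulation used by the route: by Lemma
17/23-type contiguity a small accurate C yields, for most clique-free critical H, C(H) = 0 and C(H ∪
K_A) = 1 for most k-sets A — "a random critical 1-restriction of a small monotone circuit is not an
isolated-clique detector"; edge-counting gates T_{≥t}, |t − pN| ≤ √m, flip under planting only w.p.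
O(k²/√m) each, but a size-n^{k/4} circuit has ≫ √m of them. [difficulty: open-problem] (why it might
fail: Thm 1 needs the subcritical sprinkle as negative instance after restricting by H; with one
threshold C^H need only reject ∅, so the closure method must run jointly over the random background,
where threshold sub-circuits near pN are live — no such variant exists (open since 2010, Rossman2014
§9).) [Rossman2014, doi:10.1109/focs.2010.26, Rossman2008, Rossman2017, CavalarKumarRossman2022,
Jukna2012]
#3 ConstantBand (crux) — M(w) at constant width, centre-uniform: ∀ c ∃ k ≥ 3 ∃ w ∃ δ > 0, eventually
in n, for every central j and every monotone C: Σ_{i=j−w}^{j+w} #{x : |x| = i, C(x) ≠ CLIQUE_k(x)} /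
#{x : |x| = i} ≤ δ ⟹ n^c < |C| (the uniform mixture of the 2w+1 slices; G(n,p) conditioned on the
band has the same null sets up to factors → 1). Implied by SliceTarget (TargetImpliesBand) and
implies SingleThreshold (BandImpliesThreshold): the last rung on which planted comparable pairs (H,
H ∪ K_A) still lie inside the support (needs 2w ≥ C(k,2)); below it only incomparable pairs remain
and Berkowitz applies. Intermediate forms (width m^{1/2−η}, card C2) sit between #2 and #3. [deps:
SingleThreshold] [difficulty: open-problem] (why it might fail: at constant width an edge-counting
gate separates a planted pair w.p. C(k,2)/(2w+1) = Θ(1) (vs k²/√m at one threshold), so a proof must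
show monotone circuits cannot amplify constant counting advantage; nothing is known below width √m
and the statement is NP ⊄ P/poly-adjacent (w = 0 is X).) [Rossman2014, Berkowitz1982, Valiant1986,
AmanoMaruoka2005, Jukna2012]
#4 SliceACZero (crux) — Descent of average-case AC⁰ lower bounds from G(n,q) to the slice: IF for
all d, c there are k ≥ 3, δ > 0 with, eventually in n, every depth-d {¬,∧,∨}-circuit (unbounded
fan-in, acDepth ≤ d) that errs w.p. ≤ δ on G(n,q), for any q with |q·C(n,2) − m_k(n)| ≤
m_k(n)^{3/4}, having more than n^c gates (this hypothesis is Rossman's single-threshold AC⁰ theorem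
[Rossman2008], all threshold functions q ~ p), THEN the same holds with G(n,q) replaced by every
central slice G(n,j). The sanity rung S0 of the card made closable: AC⁰ has no pseudo-complements,
so if the descent holds the entire monotone obstruction on the band axis is threshold gates;
intended proof: a depth-d size-n^c circuit is insensitive to adding/removing j^{0.6} uniformly
random edges on a central slice (switching lemma for exactly-ℓ-star restrictions; for width-t DNF
E_p[#pivotal absent edges] ≤ t/p), CLIQUE_k is too (new clique w.p. O(k² j^{−0.4})), so
slice-accuracy spreads over the ±√j·log window and gives G(n, j/C(n,2))-accuracy. [difficulty: L]
(why it might fail: needs an AC0 average-sensitivity bound under fixed-edge-count (negatively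
associated) randomness at density p → 0 with the 1/p scaling, uniformly over ALL central slices
(averaging over slices only gives most of them); false if small AC0 circuits can exploit the exact
edge count.) [Rossman2008, Amano2010, Rossman2014, Jukna2012]
#9 SliceMonotonization (support) — Berkowitz's slice theorem in crude polynomial form on edge
variables: there is c₀ such that for all n, 0 < M < C(n,2) and every B₂-circuit C on the edges of
K_n there is a {∧₂,∨₂}-circuit C′ of size ≤ c₀(|C| + n^{c₀}) with C′(x) = C(x) for all x with
exactly M edges. Proof: B₂ → De Morgan
(Literature.Computability.Complexity.Circuit.exists_deMorgan_of_B2, 12s+3), push negations to the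
inputs (×2), replace ¬x_e by the pseudo-complement T_{≥M}(x with e := 0) (a monotone DP threshold
circuit, O(N·M) gates each, N of them), constants on the slice: 1 = T_{≥M}, 0 = T_{≥M+1} (needs 0 <
M < N) [Berkowitz1982; Jukna2012 Thm 10.1; Valiant1986]. Printed overhead O(N log² N); any
polynomial suffices here. [difficulty: M] [Berkowitz1982, Jukna2012, Valiant1986, Wegener1985]
#9 CliqueCircuitsOfNPSubsetPPoly (support) — NP ⊆ P/poly ⟹ ∃ c₁ ∀ k, eventually in n, some
B₂-circuit of size ≤ n^{c₁} computes cliqueFn n k on the C(n,2) edge variables. Proof: CLIQUE ∈ NP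
(Literature.Computability.Complexity.CLIQUE_mem_NP, KarpCliqueNP.lean) ⟹ CLIQUE ∈ SIZE(p) for a
polynomial p; for fixed (n,k) every instance code (encodingGraph.pairBool encodingNatBool)(⟨n,G⟩,k)
has one length L(n,k) = O(n² + log k) and each code bit is a constant or an adjacency bit x_{ij};
feed the P/poly circuit at length L(n,k) that input layer (pattern of
Literature.Barriers.PneNP.TardosFunctionFP.exists_deMorgan_of_PPoly with complBits replaced by the
CLIQUE instance code) and compare with cliqueFn via cliqueSet = {¬CliqueFree k}; p(L(n,k)) ≤ n^{c₁}
for n ≥ n₀(k) with c₁ = 2·deg p + 1. [difficulty: M] [Karp1972, AroraBarak2009, Jukna2012]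
#9 TargetImpliesBand (support) — SliceTarget → ConstantBand: take the same k and δ and w := 0 (the
band sum is the single term err_j/#slice_j ≤ δ). Confirms the ladder is ordered; one-screen proof.
[difficulty: provable-now] [Rossman2014]
#9 BandImpliesThreshold (support) — ConstantBand → SingleThreshold: given (k, w, δ) from
ConstantBand take δ′ = δ/(4(2w+1)); if C errs w.p. ≤ δ′ on G(n,p), p = n^{−2/(k−1)}, write the error
as Σ_i b_i·errfrac_i with b_i = P[Bin(C(n,2), p) = i]; Chebyshev puts ≥ 1/2 of the binomial mass on
central i (|i − m| ≤ m^{3/4}, m = ⌊pC(n,2)⌋) eventually, and b_i/b_j → 1 uniformly for |i − j| ≤ w,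
j central; hence some central j has Σ_{|i−j|≤w} errfrac_i ≤ δ and ConstantBand applies. Elementary
but a genuine formalisation task (ratios of binomial coefficients, no CLT). [difficulty: M]
[Rossman2014, Jukna2011]

TWO-LAYER PLAN. Foreseen splits, none filed now: SingleThreshold ⇐ (RandomRestrictionClosure: a
(p,q)-sunflower/closure lemma for monotone circuits under a random critical 1-restriction, bounding
minterm growth jointly in (H, A)) → (ThresholdNoise: gates whose acceptance probability moves by
o(1) under planting contribute o(1) in total — the counting-gate budget) → SingleThreshold.
SliceACZero ⇐ (SliceInsensitivityAC0: adding j^{0.6} random edges flips a depth-d size-n^c circuit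
w.p. o(1) on every central slice) → (SliceToBinomial: accuracy on all slices of the ±√j·log j window
⟹ accuracy on G(n, j/C(n,2))) → SliceACZero. ConstantBand is not split before SingleThreshold moves.

KILL CRITERIA. (K1) SingleThreshold refuted — monotone circuits of size n^C, C independent of k,
δ-accurate for k-CLIQUE on a single critical G(n,p) for every k: closes the route (close --reason
refuted:SingleThreshold) and settles Rossman's question negatively. (K2) SliceACZero refuted (small
AC⁰ circuits accurate on a critical slice but not on G(n,q)): slices leak below threshold-gate
power; the band axis is not about pseudo-complements — pivot the thesis or close as superseded by
clique-exponent-criticality-dial if that card is routed. (K3) A proof that the closure/approximation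
method is provably width-insensitive down to w = O(1) but stops exactly at comparable pairs (a
formal slice-width barrier) turns #3 into the terminus: keep #2/#3 as results, close the route
exhausted for X. (K4) SliceTarget refuted for some fixed c (average-case k-clique on the slice in
SIZE(n^c) for all k): closes the route; NP ⊄ P/poly itself is untouched (X is stronger).

NOT DECOMPOSED YET. The (p,q)-sunflower/closure machinery under random restriction (layer 2 of #2);
the exact insensitivity lemma for #4; intermediate widths m^{1/2−η} (card C2) and the
uniform-in-density version of #2 (all q ~ p), which the glue does not need; the worst-case slice
function CLIQUE_{k}|_{slice} and central-slice NP-completeness [Wegener1985] (not used: X is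
average-case); the card's perfect-matching calibrator — dropped: at PM's own threshold PM ≡ (min
degree ≥ 1) a.a.s., so PM is monotone-easy on average at EVERY width and calibrates nothing on this
axis (it supports Rossman2017's speculation instead); the random-k-SAT face (F_k(n,m) is one slice
of the clause cube) — a remark for route Feige, no item; vendoring Rossman2008/Rossman2014 Thm 1–3
as Literature facts (cite request filed) so that #4's hypothesis can later be discharged by name.

CHEAPEST FALSIFIER. (a) Look for a k-independent exponent in any average-case k-clique algorithm at
the threshold (monotone or not): Rossman2014 Thm 3 / Amano2010 give n^{k/4+O(1)},
greedy/colour-coding/matrix-multiplication detection are n^{Θ(k)}; a single n^{O(1)} average-case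
detector at p_c for all k kills SliceTarget (general = monotone on the slice) — none is known, and
it would contradict the standard hardness belief stated in Rossman2014 §9. (b) Prove
TargetImpliesBand (minutes) and BandImpliesThreshold (days) to certify the ladder's typing; a
failure there means a quantifier/normalisation slip, repair by restate. (c) Degenerate-k audit (done
while planning, see Degenerate cases): k ≤ 2 excluded by 3 ≤ k; the trivial 0-gate circuit x_e has
slice error → 1 − e^{−1/k!} > 0, so ∃ δ is not vacuous; slices in the window are non-empty (j ≤
2m_k(n) < C(n,2)). (d) Lookup owed: Rossman's ICM 2018 survey doi:10.1142/9789813272880_0187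
(acq-01689, cite-only) for the current status of the single-threshold monotone problem; zbMATH
2026-08-15 shows no resolution.

NUMBERS. Threshold p = n^{−2/(k−1)}, m = pC(n,2) ≈ n^{2−2/(k−1)}/2, E[#K_k] → 1/k! on G(n,p) and on
G(n,m) (Poisson), so min(P[yes], P[no]) → 1 − e^{−1/k!}; √m = n^{1−1/(k−1)} ≪ n^{k/4} for k ≥ 5;
Rossman: monotone and AC⁰ average-case exponents k/4 (lower, two thresholds resp. one) and k/4 +
O(1) (upper) [Rossman2014 Thms 2–3; Rossman2008; Amano2010]; worst-case general record n^{ωk/3+O(1)}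
(Nešetřil–Poljak); Markov: ⌈log₂(2w+1)⌉ negations invert on a band of width w [Markov1958;
Fischer1975; Jukna2012 §10.2]; Berkowitz overhead O(N log² N) [Jukna2012 Thm 10.1]; planted pairs
leave the band at 2w < C(k,2).

DEFINITION REQUESTS. None blocking: all statements are typed over
Literature.Computability.Complexity.{Circuit, monotoneBasis, B2, acBasis, acDepth, PPoly,
Nondeterministic.NP} (cliqueFn written out as `decide ¬CliqueFree`; imports: Circuit,
CircuitClasses, Nondeterministic, ConstantDepth only — CircuitLowerBounds and ClayProblem dropped
2026-08-15 so the import cone carries no unproved named fact; the proved bridges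
P_bool_eq/NP_bool_eq/P_subset_PPoly enter only the PROOF of Assembly) and Mathlib (SimpleGraph ⊤
edgeSet, Finset.filter/sum, Nat.floor, Real.rpow); measures are finite sums (no PMF). Cite facts
wanted (filed separately): Rossman2014 Thm 1/2/3 and Lemma 23; Rossman2008 main theorem
(single-threshold AC⁰) — the inline hypothesis of SliceACZero.

Novelty: Searches (2026-08-15): lit search --hybrid "monotone complexity k-clique random graphs Rossman"
(held: Jukna2012; Rossman2010 text paper:doi-10-1109-focs-2010-26 read pp.1–5,10–14); zbMATH
"Rossman clique random graphs" (14 rows: SICOMP 2014 review, ICM18 survey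
doi:10.1142/9789813272880_0187 paywalled = acq-01689, Amano2010, LATIN 2020 CKR) and "monotone
circuit clique random graphs average-case lower bound" ≥ 2011 (2 proceedings rows, no resolution of
the single-threshold problem); lit galaxy search --star pdf "average-case monotone" → ECCC TR16-206
(Rossman2017) read p.20; --star all "single threshold function p(n)" 0 hits; lit frontier PneNP
--since 2020 (monotone matching arXiv:2507.16105; nothing average-case monotone); lit bridges PneNP
--cross any (nil relevant); OpenAlex/S2/arXiv 429, searchd rc75 today; the card's own sweep and two
refuter audits (gen0/gen1: new-combination) inherited. Nearest prior art found: Rossman2014 (=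
doi:10.1109/focs.2010.26) Thm 2 + §9 (single threshold posed; "n^{f(k)} general ⇒ P ≠ NP");
Rossman2017 p.20 ("plausible that syntactic monotonicity = semantic monotonicity in the
average-case", evidence: the slice distribution + Berkowitz) — NOT cited by the card and the closest
statement in print of the w = 0 end; Berkowitz1982 / Valiant1986 / Wegener1985 (slice functions,
central-slice NP-completeness: the classical worst-case "one slice suffices"); AmanoMaruoka2005
(approximation method on threshold-cut sub-domains, worst case); CavalarKumar  [refs: 10.1142/9789813272880_0187, 10.1109/focs.2010.26, 2507.16105, paper:doi-10-1109-focs-2010-26, doi:10.1142/9789813272880_0187, doi:10.1109/focs.2010.26, Jukna2012, Amano2010, Rossman2017, Rossman2014, Berkowitz1982, Valiant1986, Wegener1985, AmanoMaruoka2005, CavalarKumarRossman2022]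

Barriers (technique_class: approximation-method, monotone-circuit-lower-bounds, slices): - technique_class: approximation-method, monotone-circuit-lower-bounds, slices
- Literature.Barriers.PneNP.MonotoneGap: applies to any transfer of a worst-case or wide-band
monotone bound (Tardos's ϑ-threshold function; its proved reading `not_monotoneTransfer_pow`);
evaded at the level of statements: the only transfer used is at w = 0, where monotone = general by
Berkowitz (SliceMonotonization, the barrier file's own listed evasion "slice functions"), and cruxes
#2/#3 are declared milestones that transfer nothing by themselves; on the critical measures Tardos's
sandwich [ω ≤ ϑ(Ḡ) ≤ χ] is a.a.s. constant (ϑ(Ḡ(n,p)) → ∞ for k ≥ 4), so sandwich functions are not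
counterexamples to the average-case rungs either.
- Literature.Barriers.PneNP.ApproximationMethodLimit: Razborov 1989's ceiling is for legitimate
models over the complete basis; at w = 0 a monotone approximation-method certificate for the slice
would act as a complete-basis certificate through pseudo-complements, so it bites on X exactly as on
any general lower bound — not evaded; the bet is that #2 and #3 (w ≥ 1, genuinely monotone: no
pseudo-complements exist on two adjacent slices) are outside its scope, and the route's own
mini-barrier (planted pairs die at width C(k,2)/2) says where a new ingredient must enter.
- Literature.Barriers.PneNP.NaturalProofs: X is NP ⊄ P/poly-strength and "errs on ≤ δ of a slice" is
a large, plausibly constructive property, so a natural proof of X for k/4 above the PRF size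
exponent woul

Novelty grade: new-combination — ROUTE REVIEW gen-2 (refuter, 3rd pass; gen-0/gen-1 briefings stand). 9/9 rc0 (W2.lean); Assembly rfl; the three bridges P_bool_eq/NP_bool_eq/P_subset_PPoly are PROVED tree theorems (std axioms) — needs_repair glue.extra-hypothesis is cosmetic (drop them from the signature or list them). NEW since ge (refuter refuter-rreview-route-Langlands-Rational-1dd750bb-g2-0, 2026-08-15T14:33:22Z; prior: doi:10.1109/focs.2010.26, doi:10.1145/1374376.1374480, doi:10.1142/9789813272880_0187, Rossman2017 ECCC TR16-206, Berkowitz1982, Valiant1986, Jukna2012 Thm 10.1, AmanoMaruoka2005)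

History (route lifecycle, newest last):
- 2026-08-15T16:13:44Z · rev 2: restated Assembly (stmt-PneNP-2840) — route-repair (glue + cone): (1) deciding theorem supplied — closes : SliceTarget → SingleThreshold → ConstantBand → SliceACZero → SliceMonotonization → CliqueCi (planner-rbadge-PneNP-OneSlice-c6a9f00b-g2-0)
- 2026-08-16T04:14:33Z · AUTO-CRUX (backfill): SliceTarget — hypotheses of the deciding theorem that nothing in the route derives are cruxes (operator:999:1085951)
- 2026-08-25T02:48:27Z · DORMANT — reconciler: no traction for 7.3 d (last activity item-evidence-added at 2026-08-17T18:56:35Z); parked, not closed — `ledger route dormant route-PneNP-OneSlice - (operator:999:4161712)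

sub-problem: PneNP · status: dormant · opened planner-plancard-PneNP-PneNP-one-slice-suffic-94c1c159-0 2026-08-15T11:08:53Z · rev 6 · ledger route-PneNP-OneSlice
GENERATED by the gate from the ledger (D-0016/17). Provers cite these decls: `theorem foo : Summit.PneNP.PneNP.Theses.OneSlice.<Decl> := …` in Summits/PneNP/PneNP/Theorems/<Name>.lean.
-/

namespace Summit.PneNP.PneNP.Theses.OneSlice

open scoped BigOperators Topology Manifold Classical MeasureTheory ProbabilityTheory Matrix InnerProductSpace ComplexConjugate ContinuousMap
open Filter Set Function TopologicalSpace MeasureTheory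

attribute [summit_statement] _root_.PneNP

open Literature.PNP

/-- item stmt-PneNP-2832 · crux (kind.auto-crux: conjecture-grade) · rank 0 · open · by planner
why it might fail: Average-case k-clique on ONE critical slice may lie in SIZE(n^C) with C independent of k: on a slice monotone = general (Berkowitz), no worst-to-average reduction is known at the threshold, X is strictly stronger than NP ⊄ P/poly, and any proof of it must be non-natural (Razborov–Rudich).
sources: Rossman2014, Berkowitz1982, Valiant1986, Rossman2017, RazborovRudich1997, arXiv:1903.08247
[target] X above: ∀ c ∃ k ≥ 3 ∃ δ > 0, eventually in n, for every central edge count j and every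
monotone {∧₂,∨₂}-circuit C on the edges of K_n: #{x : |x| = j, C(x) ≠ CLIQUE_k(x)} ≤ δ·#{x : |x| =
j} ⟹ n^c < |C|. Weakest sufficient form (unbounded exponent); the expected truth is |C| ≥
n^{k/4−O(1)} [Rossman2014 §9 speculation for general circuits; Thm 3 caps it at n^{k/4+O(1)}].
Equivalent up to polynomial factors to the same statement for general B₂-circuits
(SliceMonotonization), hence STRONGER than NP ⊄ P/poly: it can fail while PneNP holds. -/
@[route_item "route-PneNP-OneSlice", crux]
def SliceTarget : Prop :=
  ∀ c : ℕ, ∃ k : ℕ, 3 ≤ k ∧ ∃ δ : ℝ, 0 < δ ∧ ∀ᶠ n : ℕ in Filter.atTop, ∀ j : ℕ, |(j : ℝ) - (⌊((n.choose 2 : ℕ) : ℝ) * (n : ℝ) ^ (-(2 : ℝ) / ((k : ℝ) - 1))⌋₊ : ℝ)| ≤ (⌊((n.choose 2 : ℕ) : ℝ) * (n : ℝ) ^ (-(2 : ℝ) / ((k : ℝ) - 1))⌋₊ : ℝ) ^ ((3 : ℝ) / 4) → ∀ C : Literature.Computability.Complexity.Circuit ((⊤ : SimpleGraph (Fin n)).edgeSet),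 C.IsOver Literature.Computability.Complexity.monotoneBasis → ((Finset.univ.filter (fun x : ((⊤ : SimpleGraph (Fin n)).edgeSet) → Bool => (Finset.univ.filter (fun e => x e = true)).card = j ∧ C.eval x ≠ decide (¬ (SimpleGraph.fromEdgeSet {e : Sym2 (Fin n) | ∃ h : e ∈ (⊤ : SimpleGraph (Fin n)).edgeSet, x ⟨e, h⟩ = true}).CliqueFree k))).card : ℝ) ≤ δ * ((Finset.univ.filter (fun x : ((⊤ : SimpleGraph (Fin n)).edgeSet) → Bool => (Finset.univ.filter (fun e => x e = true)).card = j)).card : ℝ) → n ^ c < C.size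

/-- item stmt-PneNP-2833 · crux · rank 2 · open · by planner
why it might fail: At one density there is no negative test distribution: Rossman's Thm 1/Lemma 17 reject the subcritical sprinkle G(n,p^{1+δ}) after restricting by a critical H; at a single p the approximator must beat live counting gates T_{≥t}, |t−pN| ≤ √m — no such closure lemma exists (posed open, FOCS'10 §9).
sources: Rossman2014, doi:10.1109/focs.2010.26, Rossman2008, Rossman2017, CavalarKumarRossman2022, Jukna2012
[crux] Rossman's open problem in unbounded-exponent form: ∀ c ∃ k ≥ 3 ∃ δ > 0, eventually in n,
every monotone {∧₂,∨₂}-circuit C with Pr_{G ~ G(n, n^{−2/(k−1)})}[C(G) ≠ CLIQUE_k(G)] ≤ δ has more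
than n^c gates (product measure written as the finite sum Σ_x p^{|x|}(1−p)^{C(n,2)−|x|}). Known: the
same with correctness at two densities p and p+p^{1+ε} [Rossman2014 Thm 2, strongest form p.4]; AC⁰
single threshold [Rossman2008]; upper bound n^{k/4+O(1)} monotone for every p [Rossman2014 Thm 3].
Reformulation used by the route: by Lemma 17/23-type contiguity a small accurate C yields, for most
clique-free critical H, C(H) = 0 and C(H ∪ K_A) = 1 for most k-sets A — "a random critical
1-restriction of a small monotone circuit is not an isolated-clique detector"; edge-counting gates
T_{≥t}, |t − pN| ≤ √m, flip under planting only w.p. O(k²/√m) each, but a size-n^{k/4} circuit has ≫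
√m of them. [difficulty: open-problem] -/
@[route_item "route-PneNP-OneSlice", crux]
def SingleThreshold : Prop :=
  ∀ c : ℕ, ∃ k : ℕ, 3 ≤ k ∧ ∃ δ : ℝ, 0 < δ ∧ ∀ᶠ n : ℕ in Filter.atTop, ∀ C : Literature.Computability.Complexity.Circuit ((⊤ : SimpleGraph (Fin n)).edgeSet), C.IsOver Literature.Computability.Complexity.monotoneBasis → (Finset.univ.filter (fun x : ((⊤ : SimpleGraph (Fin n)).edgeSet) → Bool => C.eval x ≠ decide (¬ (SimpleGraph.fromEdgeSet {e : Sym2 (Fin n) | ∃ h : e ∈ (⊤ : SimpleGraph (Fin n)).edgeSet, x ⟨e, h⟩ = true}).CliqueFree k))).sum (fun x => ((n : ℝ) ^ (-(2 : ℝ) / ((k : ℝ) - 1))) ^ (Finset.univ.filter (fun e => x e = true)).card * (1 - (n : ℝ) ^ (-(2 : ℝ) / ((k : ℝ) - 1))) ^ (n.choose 2 - (Finset.univ.filter (fun e => x e = true)).card)) ≤ δ → n ^ c < C.size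

/-- item stmt-PneNP-18471 · crux · rank 3 · open · by planner
why it might fail: An average-case Razborov–Tardos gap at ONE critical threshold — a transport-stable monotone graph property in P that no n^{O(1)}-size {∧₂,∨₂}-circuit approximates under G(n,p_c) — refutes it through the Berkowitz monotonization of its slice restriction; only width 0 (Berkowitz) is proved, Markov–Fis
sources: Rossman2017, Berkowitz1982, Jukna2012, Markov1958, Fischer1975, Tardos1988
[crux] MonotoneContinuation — slice-to-threshold MONOTONE CONTINUATION (Rossman's 'syntactic =
semantic monotonicity in the average case' [Rossman2017, ECCC TR16-206 p.20] made quantitative;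
width 0 = Berkowitz's slice theorem): ∀ c ∃ c' ∀ k ≥ 3 ∀ η > 0 ∃ ε > 0, eventually in n, for every
central j and every {∧₂,∨₂}-circuit C with |C| ≤ n^c: let ĝ_C(y) be the canonical transport of C's
slice-j function (the fraction of the slice-j vectors comparable with y — contained in or containing
y — that C accepts); IF ĝ_C is ε-close in L¹(G(n,p_c)), p_c = n^{-2/(k-1)}, to SOME monotone Boolean
function, THEN ĝ_C is η-close in L¹(G(n,p_c)) to the function of some {∧₂,∨₂}-circuit of size ≤
n^{c'}. GENERIC in C (no reference to CLIQUE): SliceTarget does not imply it; together with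
SingleThreshold it implies SliceTarget (assembly PROVED: Theorems-ready files
OneSliceSliceTargetSplit{Transport,Stability,}.lean, evidence) — the transport is an L¹ contraction
slice→threshold and CLIQUE_k is transport-stable (‖T𝟙[K_k] − 𝟙[K_k]‖ ≤ 4C(k,2)m^{-1/4} + Chebyshev),
so a small slice-accurate monotone C would continue to a small G(n,p_c)-accurate monotone C'.
Refutation = an average-case Razborov–Tardos gap -/
@[route_item "route-PneNP-OneSlice", crux]
def MonotoneContinuation : Prop :=
  ∀ c : ℕ, ∃ c' : ℕ, ∀ k : ℕ, 3 ≤ k → ∀ η : ℝ, 0 < η → ∃ ε : ℝ, 0 < ε ∧ ∀ᶠ n : ℕ in Filter.atTop, ∀ j : ℕ, |(j : ℝ) - (⌊((n.choose 2 : ℕ) : ℝ) * (n : ℝ) ^ (-(2 : ℝ) / ((k : ℝ) - 1))⌋₊ : ℝ)| ≤ (⌊((n.choose 2 : ℕ) : ℝ) * (n : ℝ) ^ (-(2 : ℝ) / ((k : ℝ) - 1))⌋₊ : ℝ) ^ ((3 : ℝ) / 4) → ∀ C : Literature.Computability.Complexity.Circuit ((⊤ : SimpleGraph (Fin n)).edgeSet),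 C.IsOver Literature.Computability.Complexity.monotoneBasis → C.size ≤ n ^ c → (∃ F : (((⊤ : SimpleGraph (Fin n)).edgeSet) → Bool) → Bool, Monotone F ∧ (Finset.univ.sum (fun y : ((⊤ : SimpleGraph (Fin n)).edgeSet) → Bool => ((n : ℝ) ^ (-(2 : ℝ) / ((k : ℝ) - 1))) ^ (Finset.univ.filter (fun e => y e = true)).card * (1 - ((n : ℝ) ^ (-(2 : ℝ) / ((k : ℝ) - 1)))) ^ (n.choose 2 - (Finset.univ.filter (fun e => y e = true)).card) * |(if F y = true then (1 : ℝ) else 0) - ((Finset.univ.filter (fun x : ((⊤ : SimpleGraph (Fin n)).edgeSet) → Bool => (Finset.univ.filter (fun e => x e = true)).card = j ∧ ((∀ e, x e = true → y e = true) ∨ (∀ e, y e = true → x e = true)) ∧ C.eval x = true)).card : ℝ) / ((Finset.univ.filter (fun x : ((⊤ : SimpleGraph (Fin n)).edgeSet) → Bool => (Finset.univ.filter (fun e => x e = true)).card = j ∧ ((∀ e, x e = true → y e = true) ∨ (∀ e, y e = true → x e = true)))).card : ℝ)|)) ≤ ε) → ∃ C' : Literature.Computability.Complexity.Circuit ((⊤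 : SimpleGraph (Fin n)).edgeSet), C'.IsOver Literature.Computability.Complexity.monotoneBasis ∧ C'.size ≤ n ^ c' ∧ (Finset.univ.sum (fun y : ((⊤ : SimpleGraph (Fin n)).edgeSet) → Bool => ((n : ℝ) ^ (-(2 : ℝ) / ((k : ℝ) - 1))) ^ (Finset.univ.filter (fun e => y e = true)).card * (1 - ((n : ℝ) ^ (-(2 : ℝ) / ((k : ℝ) - 1)))) ^ (n.choose 2 - (Finset.univ.filter (fun e => y e = true)).card) * |(if C'.eval y = true then (1 : ℝ) else 0) - ((Finset.univ.filter (fun x : ((⊤ : SimpleGraph (Fin n)).edgeSet) → Bool => (Finset.univ.filter (fun e => x e = true)).card = j ∧ ((∀ e, x e = true → y e = true) ∨ (∀ e, y e = true → x e = true)) ∧ C.eval x = true)).card : ℝ) / ((Finset.univ.filter (fun x : ((⊤ : SimpleGraph (Fin n)).edgeSet) → Bool => (Finset.univ.filter (fun e => x e = true)).card = j ∧ ((∀ e, x e = true → y e = true) ∨ (∀ e, y e = true → x e = true)))).card : ℝ)|)) ≤ η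

/-- item stmt-PneNP-2834 · crux · rank 3 · open · by planner
why it might fail: At constant width w an edge-count gate T_{≥j+w+1} separates a planted pair (H, H∪K_A) w.p. Θ(C(k,2)/(2w+1)) instead of O(k²/√m), so a proof must show small monotone circuits cannot amplify Θ(1) counting advantage; nothing is known below width √m, and the statement implies the open SingleThreshold.
sources: Rossman2014, Berkowitz1982, Valiant1986, AmanoMaruoka2005, Jukna2012
[crux] M(w) at constant width, centre-uniform: ∀ c ∃ k ≥ 3 ∃ w ∃ δ > 0, eventually in n, for every
central j and every monotone C: Σ_{i=j−w}^{j+w} #{x : |x| = i, C(x) ≠ CLIQUE_k(x)} / #{x : |x| = i}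
≤ δ ⟹ n^c < |C| (the uniform mixture of the 2w+1 slices; G(n,p) conditioned on the band has the same
null sets up to factors → 1). Implied by SliceTarget (TargetImpliesBand) and implies SingleThreshold
(BandImpliesThreshold): the last rung on which planted comparable pairs (H, H ∪ K_A) still lie
inside the support (needs 2w ≥ C(k,2)); below it only incomparable pairs remain and Berkowitz
applies. Intermediate forms (width m^{1/2−η}, card C2) sit between #2 and #3. [deps:
SingleThreshold] [difficulty: open-problem] -/
@[route_item "route-PneNP-OneSlice", crux]
def ConstantBand : Prop :=
  ∀ c : ℕ, ∃ k : ℕ, 3 ≤ k ∧ ∃ w : ℕ, ∃ δ : ℝ, 0 < δ ∧ ∀ᶠ n : ℕ in Filter.atTop, ∀ j : ℕ, |(j : ℝ) - (⌊((n.choose 2 : ℕ) : ℝ) * (n : ℝ) ^ (-(2 : ℝ) / ((k : ℝ) - 1))⌋₊ : ℝ)| ≤ (⌊((n.choose 2 : ℕ) : ℝ) * (n : ℝ) ^ (-(2 : ℝ) / ((k : ℝ) - 1))⌋₊ : ℝ) ^ ((3 : ℝ) / 4) → ∀ C : Literature.Computability.Complexity.Circuit ((⊤ : SimpleGraph (Fin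 n)).edgeSet), C.IsOver Literature.Computability.Complexity.monotoneBasis → (Finset.Icc (j - w) (j + w)).sum (fun i => ((Finset.univ.filter (fun x : ((⊤ : SimpleGraph (Fin n)).edgeSet) → Bool => (Finset.univ.filter (fun e => x e = true)).card = i ∧ C.eval x ≠ decide (¬ (SimpleGraph.fromEdgeSet {e : Sym2 (Fin n) | ∃ h : e ∈ (⊤ : SimpleGraph (Fin n)).edgeSet, x ⟨e, h⟩ = true}).CliqueFree k))).card : ℝ) / ((Finset.univ.filter (fun x : ((⊤ : SimpleGraph (Fin n)).edgeSet) → Bool => (Finset.univ.filter (fun e => x e = true)).card = i)).card : ℝ)) ≤ δ → n ^ c < C.size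

/-- item stmt-PneNP-2835 · crux · rank 4 · closed · proved by Summit.PneNP.PneNP.Cruxes.SliceACZero.RussoWindowLadder.sliceACZero_proof @ 841a945e9c9a (prover) · by planner
why it might fail: Needs an average-sensitivity/switching bound for depth-d size-n^c circuits under exactly-j-edge (negatively associated) randomness at p → 0 with 1/p scaling, uniformly over ALL central j; false if poly-size AC⁰ exploits the exact edge count. HYP = fixed-δ strengthening of Rossman2008: vacuity risk.
sources: Rossman2008, Amano2010, Rossman2014, Jukna2012
[crux] Descent of average-case AC⁰ lower bounds from G(n,q) to the slice: IF for all d, c there are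
k ≥ 3, δ > 0 with, eventually in n, every depth-d {¬,∧,∨}-circuit (unbounded fan-in, acDepth ≤ d)
that errs w.p. ≤ δ on G(n,q), for any q with |q·C(n,2) − m_k(n)| ≤ m_k(n)^{3/4}, having more than
n^c gates (this hypothesis is Rossman's single-threshold AC⁰ theorem [Rossman2008], all threshold
functions q ~ p), THEN the same holds with G(n,q) replaced by every central slice G(n,j). The sanity
rung S0 of the card made closable: AC⁰ has no pseudo-complements, so if the descent holds the entire
monotone obstruction on the band axis is threshold gates; intended proof: a depth-d size-n^c circuit
is insensitive to adding/removing j^{0.6} uniformly random edges on a central slice (switching lemma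
for exactly-ℓ-star restrictions; for width-t DNF E_p[#pivotal absent edges] ≤ t/p), CLIQUE_k is too
(new clique w.p. O(k² j^{−0.4})), so slice-accuracy spreads over the ±√j·log window and gives G(n,
j/C(n,2))-accuracy. [difficulty: L] -/
@[route_item "route-PneNP-OneSlice", crux]
def SliceACZero : Prop :=
  (∀ d c : ℕ, ∃ k : ℕ, 3 ≤ k ∧ ∃ δ : ℝ, 0 < δ ∧ ∀ᶠ n : ℕ in Filter.atTop, ∀ q : ℝ, 0 ≤ q → q ≤ 1 → |q * (n.choose 2 : ℕ) - (⌊((n.choose 2 : ℕ) : ℝ) * (n : ℝ) ^ (-(2 : ℝ) / ((k : ℝ) - 1))⌋₊ : ℝ)| ≤ (⌊((n.choose 2 : ℕ) : ℝ) * (n : ℝ) ^ (-(2 : ℝ) / ((k : ℝ) - 1))⌋₊ : ℝ) ^ ((3 : ℝ) / 4) → ∀ C : Literature.Computability.Complexity.Circuit ((⊤ : SimpleGraph (Fin n)).edgeSet), C.IsOver Literature.Computability.Complexity.acBasis → C.acDepth ≤ d → (Finset.univ.filter (fun x : ((⊤ : SimpleGraph (Fin n)).edgeSet) → Bool => C.eval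 x ≠ decide (¬ (SimpleGraph.fromEdgeSet {e : Sym2 (Fin n) | ∃ h : e ∈ (⊤ : SimpleGraph (Fin n)).edgeSet, x ⟨e, h⟩ = true}).CliqueFree k))).sum (fun x => (q) ^ (Finset.univ.filter (fun e => x e = true)).card * (1 - q) ^ (n.choose 2 - (Finset.univ.filter (fun e => x e = true)).card)) ≤ δ → n ^ c < C.size) → (∀ d c : ℕ, ∃ k : ℕ, 3 ≤ k ∧ ∃ δ : ℝ, 0 < δ ∧ ∀ᶠ n : ℕ in Filter.atTop, ∀ j : ℕ, |(j : ℝ) - (⌊((n.choose 2 : ℕ) : ℝ) * (n : ℝ) ^ (-(2 : ℝ) / ((k : ℝ) - 1))⌋₊ : ℝ)| ≤ (⌊((n.choose 2 : ℕ) : ℝ) * (n : ℝ) ^ (-(2 : ℝ) / ((k : ℝ) - 1))⌋₊ : ℝ) ^ ((3 : ℝ) / 4) → ∀ C : Literature.Computability.Complexity.Circuit ((⊤ : SimpleGraph (Fin n)).edgeSet), C.IsOver Literature.Computability.Complexity.acBasis → C.acDepth ≤ d → ((Finset.univ.filter (fun x : ((⊤ : SimpleGraph (Fin n)).edgeSet)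 → Bool => (Finset.univ.filter (fun e => x e = true)).card = j ∧ C.eval x ≠ decide (¬ (SimpleGraph.fromEdgeSet {e : Sym2 (Fin n) | ∃ h : e ∈ (⊤ : SimpleGraph (Fin n)).edgeSet, x ⟨e, h⟩ = true}).CliqueFree k))).card : ℝ) ≤ δ * ((Finset.univ.filter (fun x : ((⊤ : SimpleGraph (Fin n)).edgeSet) → Bool => (Finset.univ.filter (fun e => x e = true)).card = j)).card : ℝ) → n ^ c < C.size)

/-- item stmt-PneNP-14083 · support · rank 9 · closed · proved by Summit.PneNP.PneNP.Theorems.shallowSliceBound_proof @ 37e3c03861e1 (prover) · by planner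
[support] Bounded-depth rung of X, filed as the salvage of crux #3's line `sharpness-sandwich`
(crux-plan r1, triage r1 ×3: "file the bounded-depth theorem"): ∀ d c ∃ k ≥ 3 ∃ δ > 0, eventually in
n, for every central j, every MONOTONE unbounded-fan-in {∧ₘ,∨ₘ}-circuit of and/or-depth ≤ d that
errs on ≤ δ·#slice_j graphs of the single slice G(n,j) has > n^c gates. It is the
bounded-depth/unbounded-fan-in special case of SliceTarget (and of ConstantBand at w = 0) and
literally the conclusion of SliceACZero (crux #4) restricted to monotone circuits — but provable
WITHOUT #4's Rossman2008-type hypothesis: the lower-bound engine is Rossman FOCS'10 Thm 1, PROVED in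
tree (thm1_finite / Rossman2010_cliqueVsSubcritical_holds). Skeleton (kernel-checked composition
ShallowSliceConc_of, 4 stubs; Cruxes/ConstantBand/Lines/sharpness-sandwich.lean): stub_forcingUp
(heart, L: slice accuracy + Cauchy–Schwarz planted acceptance (E_j[ω²]/E_j[ω]² → 1+k!) + Thm 1 on
C^H + Sym(E)-exchangeability + Chebyshev ⇒ the circuit accepts ≥ 1−η of EVERY slice t ≥ j +
j^{1−θ}); stub_shallowNotSharp (M/L: a depth-d size-j^c acBasis circuit changes its slice acceptance
by ≤ 1/4 inside [j, j + j^{1−θ}] — Boppana/Tal t -/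
@[route_item "route-PneNP-OneSlice", crux]
def ShallowSliceBound : Prop :=
  ∀ d c : ℕ, ∃ k : ℕ, 3 ≤ k ∧ ∃ δ : ℝ, 0 < δ ∧ ∀ᶠ n : ℕ in Filter.atTop, ∀ j : ℕ, |(j : ℝ) - (⌊((n.choose 2 : ℕ) : ℝ) * (n : ℝ) ^ (-(2 : ℝ) / ((k : ℝ) - 1))⌋₊ : ℝ)| ≤ (⌊((n.choose 2 : ℕ) : ℝ) * (n : ℝ) ^ (-(2 : ℝ) / ((k : ℝ) - 1))⌋₊ : ℝ) ^ ((3 : ℝ) / 4) → ∀ C : Literature.Computability.Complexity.Circuit ((⊤ : SimpleGraph (Fin n)).edgeSet), C.IsOver (⋃ m : ℕ, ({Literature.Computability.Complexity.GateFn.and m, Literature.Computability.Complexity.GateFn.or m} : Set Literature.Computability.Complexity.GateFn)) → C.acDepth ≤ d → ((Finset.univ.filter (fun x : ((⊤ : SimpleGraph (Fin n)).edgeSet) → Bool => (Finset.univ.filter (fun e => x e = true)).card = j ∧ C.eval x ≠ decide (¬ (SimpleGraph.fromEdgeSet {e : Sym2 (Fin n) | ∃ h : e ∈ (⊤ : SimpleGraph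 (Fin n)).edgeSet, x ⟨e, h⟩ = true}).CliqueFree k))).card : ℝ) ≤ δ * ((Finset.univ.filter (fun x : ((⊤ : SimpleGraph (Fin n)).edgeSet) → Bool => (Finset.univ.filter (fun e => x e = true)).card = j)).card : ℝ) → n ^ c < C.size

/-- item stmt-PneNP-18972 · support · rank 9 · closed · proved by Summit.PneNP.PneNP.Theorems.sliceTargetOfContinuation_proof @ f025b3149738 (prover) · by planner
[support] Glue of the crux-strategist decomposition SliceTarget ⟸ MonotoneContinuation ∧
SingleThreshold (strategist r1 on stmt-PneNP-2832, line `monotone-continuation-split`):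
MonotoneContinuation → SingleThreshold → SliceTarget. Makes SingleThreshold (rank 2) and
MonotoneContinuation (rank 3) load-bearing in `closes`. PROOF IN HAND (kernel-checked by the
strategist: rc0, 0 sorry, axioms {propext, Classical.choice, Quot.sound}):
Cruxes/SliceTarget/Lines/monotone_continuation_split.lean = the three Theorems-ready files
OneSliceSliceTargetSplitTransport.lean (LANDED p140142) · OneSliceSliceTargetSplitStability.lean ·
OneSliceSliceTargetSplit.lean, closing theorem
Summit.PneNP.PneNP.Theorems.SliceTargetSplit.sliceTarget_of_monotoneContinuation_of_singleThreshold;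
once parts II–III land this item closes by `exact
sliceTarget_of_monotoneContinuation_of_singleThreshold`. Argument: fix c; MonotoneContinuation gives
c'; SingleThreshold at c' gives (k ≥ 3, δ_S); MonotoneContinuation at (k, η := δ_S/3) gives ε; δ :=
min(ε/2, δ_S/3). For central j and a monotone C with |C| ≤ n^c and slice error ≤ δ·#slice_j: the
slice-j transport T is an L¹(G(n,p_c)) contraction (‖T𝟙[C] − T𝟙[K_k]‖ ≤ δ) and C -/
@[route_item "route-PneNP-OneSlice", crux]
def SliceTargetOfContinuation : Prop :=
  MonotoneContinuation → SingleThreshold → SliceTarget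

/-- item stmt-PneNP-2836 · support · rank 9 · closed · proved by Summit.PneNP.PneNP.Theorems.sliceMonotonization_proof (prover) · by planner
sources: Berkowitz1982, Jukna2012, Valiant1986, Wegener1985
[support] Berkowitz's slice theorem in crude polynomial form on edge variables: there is c₀ such
that for all n, 0 < M < C(n,2) and every B₂-circuit C on the edges of K_n there is a {∧₂,∨₂}-circuit
C′ of size ≤ c₀(|C| + n^{c₀}) with C′(x) = C(x) for all x with exactly M edges. Proof: B₂ → De
Morgan (Literature.Computability.Complexity.Circuit.exists_deMorgan_of_B2, 12s+3), push negations to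
the inputs (×2), replace ¬x_e by the pseudo-complement T_{≥M}(x with e := 0) (a monotone DP
threshold circuit, O(N·M) gates each, N of them), constants on the slice: 1 = T_{≥M}, 0 = T_{≥M+1}
(needs 0 < M < N) [Berkowitz1982; Jukna2012 Thm 10.1; Valiant1986]. Printed overhead O(N log² N);
any polynomial suffices here. [difficulty: M] -/
@[route_item "route-PneNP-OneSlice", crux]
def SliceMonotonization : Prop :=
  ∃ c₀ : ℕ, ∀ (n M : ℕ) (C : Literature.Computability.Complexity.Circuit ((⊤ : SimpleGraph (Fin n)).edgeSet)), C.IsOver Literature.Computability.Complexity.B2 → 0 < M → M < n.choose 2 → ∃ C' : Literature.Computability.Complexity.Circuit ((⊤ : SimpleGraph (Fin n)).edgeSet), C'.IsOver Literature.Computability.Complexity.monotoneBasis ∧ C'.size ≤ c₀ * (C.size + n ^ c₀) ∧ ∀ x : ((⊤ : SimpleGraph (Fin n)).edgeSet) → Bool, (Finset.univ.filter (fun e => x e = true)).card = M → C'.eval x = C.eval x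

/-- item stmt-PneNP-2837 · support · rank 9 · closed · proved by Summit.PneNP.PneNP.Theorems.cliqueCircuitsOfNPSubsetPPoly_proof (prover) · by planner
sources: Karp1972, AroraBarak2009, Jukna2012
[support] NP ⊆ P/poly ⟹ ∃ c₁ ∀ k, eventually in n, some B₂-circuit of size ≤ n^{c₁} computes
cliqueFn n k on the C(n,2) edge variables. Proof: CLIQUE ∈ NP
(Literature.Computability.Complexity.CLIQUE_mem_NP, KarpCliqueNP.lean) ⟹ CLIQUE ∈ SIZE(p) for a
polynomial p; for fixed (n,k) every instance code (encodingGraph.pairBool encodingNatBool)(⟨n,G⟩,k)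
has one length L(n,k) = O(n² + log k) and each code bit is a constant or an adjacency bit x_{ij};
feed the P/poly circuit at length L(n,k) that input layer (pattern of
Literature.Barriers.PneNP.TardosFunctionFP.exists_deMorgan_of_PPoly with complBits replaced by the
CLIQUE instance code) and compare with cliqueFn via cliqueSet = {¬CliqueFree k}; p(L(n,k)) ≤ n^{c₁}
for n ≥ n₀(k) with c₁ = 2·deg p + 1. [difficulty: M] -/
@[route_item "route-PneNP-OneSlice", crux]
def CliqueCircuitsOfNPSubsetPPoly : Prop :=
  Literature.Computability.Complexity.Nondeterministic.NP ⊆ Literature.Computability.Complexity.PPoly → ∃ c₁ : ℕ, ∀ k : ℕ, ∀ᶠ n : ℕ in Filter.atTop, ∃ C : Literature.Computability.Complexity.Circuit ((⊤ : SimpleGraph (Fin n)).edgeSet), C.IsOver Literature.Computability.Complexity.B2 ∧ C.Computes (fun x => decide (¬ (SimpleGraph.fromEdgeSet {e : Sym2 (Fin n) | ∃ h : e ∈ (⊤ : SimpleGraph (Fin n)).edgeSet, x ⟨e, h⟩ = true}).CliqueFree k)) ∧ C.size ≤ n ^ c₁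

/-- item stmt-PneNP-2838 · support · rank 9 · closed · proved by Summit.PneNP.PneNP.Theorems.targetImpliesBand_proof (prover) · by planner
sources: Rossman2014
[support] SliceTarget → ConstantBand: take the same k and δ and w := 0 (the band sum is the single
term err_j/#slice_j ≤ δ). Confirms the ladder is ordered; one-screen proof. [difficulty:
provable-now] -/
@[route_item "route-PneNP-OneSlice", crux]
def TargetImpliesBand : Prop :=
  SliceTarget → ConstantBand

/-- item stmt-PneNP-2839 · support · rank 9 · closed · proved by Summit.PneNP.PneNP.Theorems.bandImpliesThreshold_proof (prover) · by planner
sources: Rossman2014, Jukna2011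
[support] ConstantBand → SingleThreshold: given (k, w, δ) from ConstantBand take δ′ = δ/(4(2w+1));
if C errs w.p. ≤ δ′ on G(n,p), p = n^{−2/(k−1)}, write the error as Σ_i b_i·errfrac_i with b_i =
P[Bin(C(n,2), p) = i]; Chebyshev puts ≥ 1/2 of the binomial mass on central i (|i − m| ≤ m^{3/4}, m
= ⌊pC(n,2)⌋) eventually, and b_i/b_j → 1 uniformly for |i − j| ≤ w, j central; hence some central j
has Σ_{|i−j|≤w} errfrac_i ≤ δ and ConstantBand applies. Elementary but a genuine formalisation task
(ratios of binomial coefficients, no CLT). [difficulty: M] -/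
@[route_item "route-PneNP-OneSlice", crux]
def BandImpliesThreshold : Prop :=
  ConstantBand → SingleThreshold

-- earlier Assembly (stmt-PneNP-2840, replaced 2026-08-15T16:13:44Z -> stmt-PneNP-10382): retired by None — SliceMonotonization → CliqueCircuitsOfNPSubsetPPoly → Literature.Computability.Complexity.P_bool_eq → Literature.Computability.Complexity.NP_bool_eq → Literature.Computability.Complexity.P_subset_PPoly → SliceTarget → PneNP
/-- item stmt-PneNP-10382 · assembly · rank 1 · closed · proved by Summit.PneNP.PneNP.Theorems.oneSlice_assembly_proof @ 3ffeb756c9fb (prover) · by planner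
sources: Berkowitz1982, AroraBarak2009, Rossman2014
[assembly] SliceMonotonization → CliqueCircuitsOfNPSubsetPPoly → SliceTarget → PneNP. By
contradiction: ¬PneNP gives NP Bool ⊆ P Bool in Cook's model (Wave0); the PROVED model bridges
P_bool_eq_holds (ClayProblem), NP_bool_eq_holds (ClayProblemProofs), P_subset_PPoly_holds
(CircuitClassesUniformProofs) — used INSIDE the proof and imported by the Theorems file, not
hypotheses and not imports of the route file — give Nondeterministic.NP ⊆ PPoly;
CliqueCircuitsOfNPSubsetPPoly yields B₂-circuits of size ≤ n^{c₁} for CLIQUE_k, every k, large n;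
SliceMonotonization at M = ⌊C(n,2)·n^{−2/(k−1)}⌋₊ (0 < M < C(n,2) eventually since k ≥ 3) gives a
monotone circuit exact on slice M of size ≤ c₀(n^{c₁}+n^{c₀}) < n^{c₀+c₁+1} for n > 2c₀; SliceTarget
at c = c₀+c₁+1, j = M (error set empty, 0 ≤ δ·#slice) gives n^c < size: contradiction on the
intersection of four eventually-sets. Candidate proof in hand: evidence OneSliceAssembly.lean on
stmt-PneNP-2840 (rc0, sorry-free, written for the OLD signature with the three bridges as hypotheses
— instantiate them with the `_holds` theorems). [difficulty: M] [sources: Berkowitz1982,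
AroraBarak2009, Rossman2014] -/
@[route_item "route-PneNP-OneSlice", crux]
def Assembly : Prop :=
  SliceMonotonization → CliqueCircuitsOfNPSubsetPPoly → SliceTarget → PneNP

/-! D-0027 §2.1 — DECIDING THEOREM (planner-authored via `route open/edit --closes-file`; by planner-rrepair-PneNP-OneSlice-unused-e65e24b0-0 2026-08-17T03:15:10Z):
its hypotheses are this route's items and its conclusion the sub-problem Statement (glue_lint), and it elaborates with this file. -/

@[closes "route-PneNP-OneSlice"] theorem closes (_hTarget : SliceTarget) (hSingle : SingleThreshold) (hCont : MonotoneContinuation)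
    (_hBand : ConstantBand) (_hAC : SliceACZero) (hMono : SliceMonotonization)
    (hClique : CliqueCircuitsOfNPSubsetPPoly) (_hTB : TargetImpliesBand) (_hBT : BandImpliesThreshold)
    (_hShallow : ShallowSliceBound) (hSplit : SliceTargetOfContinuation) (hA : Assembly) : _root_.PneNP :=
  hA hMono hClique (hSplit hCont hSingle)

end Summit.PneNP.PneNP.Theses.OneSlice
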